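import Summits.KontsevichZagierPeriods.Zeta5Search.Barrier.ConeGammaLemmaFBox
import Summits.KontsevichZagierPeriods.Zeta5Search.Barrier.ConeGammaLemmaFMembersFlow

/-!
# ζ(5) search — BARRIER: kernel ENCLOSURES of the WINDOWED Lemma F bound with members (u-windows × 42-family)
# at rational directions — the real-side forms and the computable checker

HONEST FRAMING (cell `pub-zeta5`): systematic search; no irrationality claim unless kernel-certified. Kernel ARITHMETIC
(outward-rounded fixed-point enclosures, the tree's `NumericsMP.MI` at scale `2^60`) of the explicit upper bound of P2 g24's
WINDOWED LEMMA F WITH MEMBERS (`ConeGammaLemmaFMembersFlow.phi30_le_windows_members`): for a direction `s` of the closed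
box, cut points `0 < U₀ ≤ ⋯ ≤ U_W` and one member `(v_w, w_w)` of cert-2 g33's KERNEL 42-family per window,
`Φ(aOfS s) ≤ Σ_{w<W} [c_w(1/U_w − 1/U_{w+1}) − (T_w(U_w) − T_w(U_{w+1}))] + c_W/U_W − T_W(U_W)` with the explicit
`J`-functionals `T_w(R) = Σ_m ε_m x_m ∫_R^{R x_m} {t}t⁻² dt`. Every such bound and `Φ = phi30` is a MODEL-side object under
Brown–Zudilin's (28)+(30) ((28) observed, not proved); the member / window CHOICES are data of a certificate (the inequality
holds for any choice). Nothing here is about C₀ / C₁ / δ₂₈ (so NO γ-statement anywhere), any γ of record, the cone's sup,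
C2 (OPEN), S-E (CONJECTURED), (TD_A) or `ζ(5)`; no number of record moves; records in print UNMOVED. Theory seat cert-2 g35
(item «WINDOWED LEMMA F NUMERICS IN THE KERNEL — POINTS», INBOX plan 2026-08-27), part 1: forms and checker; the soundness
theorems are `ConeGammaLemmaFWinSound`, the certificates `ConeGammaLemmaFWinPoints`.

THE ARITHMETIC FACT USED (P2 g24's `integral_fract_div_sq_cell`, cell by cell): with
`δ(a,b) := ∫_a^b {w}w⁻² dw − log(b/a) = −Σ_cells n·(1/a_n − 1/b_n)` (a RATIONAL number at rational `0 < a ≤ b`),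
every FINITE-window term is rational: `x·(J(U,x) − J(V,x)) = x·(δ(U,V) − δ(Ux,Vx))`; only the tail window carries
`x·J(U,x) = x log x + x·δ(U,Ux)` (`x ≥ 1`) / `x log x − x·δ(Ux,U)` (`x < 1`) — logarithms of naturals via `MI.logNat2`.

* Real side: `dG` (= δ), `jT x R = x·∫_R^{Rx}{t}t⁻²`, `memShape` (the 25-term signed feature pattern of member `(v,w)`,
  reoriented as in `torusN_flow_le_member`), `memT` (= P2's `T_w(R)` VERBATIM), `memC` (= `1 + #flips`), `winForm`
  (= P2's bound VERBATIM), and `phi30_aOfS_le_winForm` (P2's theorem restated with these names, by `exact`).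
* Computable side (integer data only): `cellTerm`/`deltaEnc`/`deltaE`, `jWinEnc`, `jTailEnc`, `memShapeEnc`, `cnt`,
  `winTerm`/`tailTerm`/`winSum`, the well-formedness checks and `winCheck` (upper) / `winCheck2` (two-sided).
-/

open Finset Set MeasureTheory
open Literature.Analysis.ValidatedNumerics.NumericsMP

namespace Summit.KontsevichZagierPeriods.Zeta5Search.Barrier.ConeGamma

namespace LemmaFWin

open LemmaFBox (SC lnNat)

/-! ### Real side -/

/-- `δ(a,b) := ∫_a^b {w} w⁻² dw − log(b/a)` (a rational number at rational `0 < a ≤ b`: minus the cell sums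
`Σ n(1/a_n − 1/b_n)`). -/
noncomputable def dG (a b : ℝ) : ℝ := (∫ w in a..b, Int.fract w / w ^ 2) - Real.log (b / a)

/-- The `J`-term `x · ∫_R^{R·x} {t} t⁻² dt` (at `x = 0` the factor `x` kills the junk integral, as in P2 g24's files). -/
noncomputable def jT (x R : ℝ) : ℝ := x * ∫ t in R..(R * x), Int.fract t / t ^ 2

/-- The signed 25-term feature pattern of member `(v,w)` at direction `s` applied to a function `g` of the feature value:
the terms of `torusN_flow_le_member` (`+x₀+x_v`, `+x₀−x_v`, `−2(x_v+x_w)`, the reoriented differences, `−(x_v+x_j)`,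
the six reference-path sums, `−(x₀−x₂)`, `−(x₀−x₃)`). -/
noncomputable def memShape (s : Fin 8 → ℝ) (v w : Fin 7) (g : ℝ → ℝ) : ℝ :=
  g (s 0 + s v.succ) + g (s 0 - s v.succ) - 2 * g (s v.succ + s w.succ)
  + (∑ i : Fin 7, if i = v ∨ i = w then (0 : ℝ) else
      if s i.succ ≤ s v.succ then g (s v.succ - s i.succ) else -g (s i.succ - s v.succ))
  - (∑ j : Fin 7, if j = v ∨ j = w then (0 : ℝ) else g (s v.succ + s j.succ))
  + (g (s 3 + s 5) + g (s 4 + s 6) + g (s 1 + s 6) + g (s 1 + s 7) + g (s 4 + s 5) + g (s 2 + s 7))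
  - g (s 0 - s 2) - g (s 0 - s 3)

/-- **P2 g24's window functional `T_w(R)` for member `(v,w)`, VERBATIM** (the first conjunct of
`phi30_le_windows_members` with `p w := v`, `q w := w`). -/
noncomputable def memT (s : Fin 8 → ℝ) (v w : Fin 7) (R : ℝ) : ℝ :=
  (s 0 + s v.succ) * (∫ t in R..(R * (s 0 + s v.succ)), Int.fract t / t ^ 2)
  + (s 0 - s v.succ) * (∫ t in R..(R * (s 0 - s v.succ)), Int.fract t / t ^ 2)
  - 2 * ((s v.succ + s w.succ) * ∫ t in R..(R * (s v.succ + s w.succ)), Int.fract t / t ^ 2)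
  + (∑ i : Fin 7, if i = v ∨ i = w then (0 : ℝ) else
      if s i.succ ≤ s v.succ then
        (s v.succ - s i.succ) * ∫ t in R..(R * (s v.succ - s i.succ)), Int.fract t / t ^ 2
      else -((s i.succ - s v.succ) * ∫ t in R..(R * (s i.succ - s v.succ)), Int.fract t / t ^ 2))
  - (∑ j : Fin 7, if j = v ∨ j = w then (0 : ℝ) else
      (s v.succ + s j.succ) * ∫ t in R..(R * (s v.succ + s j.succ)), Int.fract t / t ^ 2)
  + ((s 3 + s 5) * (∫ t in R..(R * (s 3 + s 5)), Int.fract t / t ^ 2)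
    + (s 4 + s 6) * (∫ t in R..(R * (s 4 + s 6)), Int.fract t / t ^ 2)
    + (s 1 + s 6) * (∫ t in R..(R * (s 1 + s 6)), Int.fract t / t ^ 2)
    + (s 1 + s 7) * (∫ t in R..(R * (s 1 + s 7)), Int.fract t / t ^ 2)
    + (s 4 + s 5) * (∫ t in R..(R * (s 4 + s 5)), Int.fract t / t ^ 2)
    + (s 2 + s 7) * (∫ t in R..(R * (s 2 + s 7)), Int.fract t / t ^ 2))
  - (s 0 - s 2) * (∫ t in R..(R * (s 0 - s 2)), Int.fract t / t ^ 2)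
  - (s 0 - s 3) * (∫ t in R..(R * (s 0 - s 3)), Int.fract t / t ^ 2)

/-- `T_w(R)` is the member pattern applied to `x ↦ jT x R`. -/
theorem memT_eq_memShape (s : Fin 8 → ℝ) (v w : Fin 7) (R : ℝ) :
    memT s v w R = memShape s v w (fun x => jT x R) := rfl

/-- `c_w = 1 + #{i ∉ {v,w} : s_i > s_v}` (the flip count of P2 g24's bound). -/
noncomputable def memC (s : Fin 8 → ℝ) (v w : Fin 7) : ℝ :=
  1 + ∑ i : Fin 7, if i = v ∨ i = w then (0 : ℝ) else if s i.succ ≤ s v.succ then 0 else 1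

/-- **P2 g24's windowed bound, VERBATIM** (second conjunct of `phi30_le_windows_members`):
`Σ_{w<W} [c_w(1/U_w − 1/U_{w+1}) − (T_w(U_w) − T_w(U_{w+1}))] + c_W/U_W − T_W(U_W)`. -/
noncomputable def winForm (s : Fin 8 → ℝ) (W : ℕ) (U : ℕ → ℝ) (p q : ℕ → Fin 7) : ℝ :=
  (∑ w ∈ Finset.range W, (memC s (p w) (q w) * (1 / U w - 1 / U (w + 1))
      - (memT s (p w) (q w) (U w) - memT s (p w) (q w) (U (w + 1)))))
  + (memC s (p W) (q W) / U W - memT s (p W) (q W) (U W))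

/-- **WINDOWED LEMMA F WITH MEMBERS** (P2 g24's `phi30_le_windows_members`) in the names of this file:
`Φ(aOfS s) ≤ winForm s W U p q`. -/
theorem phi30_aOfS_le_winForm (s : Fin 8 → ℝ) (h0 : 0 < s 0) (hlo : ∀ j : Fin 7, 0 ≤ s j.succ)
    (hhi : ∀ j : Fin 7, s j.succ ≤ s 0) (W : ℕ) (U : ℕ → ℝ) (hU0 : 0 < U 0)
    (hh : ∀ k : Fin 28, U 0 * h28 (aOfS s) k ≤ 1) (hU : ∀ w < W, U w ≤ U (w + 1))
    (p q : ℕ → Fin 7) (hpq : ∀ w ≤ W, p w ≠ q w) :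
    phi30 (aOfS s) ≤ winForm s W U p q := by
  obtain ⟨T, hT, hB⟩ := phi30_le_windows_members s h0 hlo hhi W U hU0 hh hU p q hpq
  have e : ∀ w R, T w R = memT s (p w) (q w) R := fun w R => by rw [hT]; rfl
  simp only [e] at hB
  exact hB

/-! ### Computable side (integer data; `MI` at scale `SC = 2^60`) -/

/-- The zero interval. -/
def zI : MI := ⟨0, 0⟩

/-- One cell: encloses `−n·(M/P − M/Q)`. -/
def cellTerm (M n P Q : ℕ) : MI :=
  (MI.ofFrac SC ((n * M : ℕ) : ℤ) Q).sub (MI.ofFrac SC ((n * M : ℕ) : ℤ) P)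

/-- `δ(P/M, Q/M)` by structural recursion over the integer cells between `P/M` and `Q/M` (`fuel` = number of cells). -/
def deltaEnc (M : ℕ) : ℕ → ℕ → ℕ → MI
  | 0, _, _ => zI
  | fuel + 1, P, Q =>
    if Q ≤ (P / M + 1) * M then cellTerm M (P / M) P Q
    else (cellTerm M (P / M) P ((P / M + 1) * M)).add (deltaEnc M fuel ((P / M + 1) * M) Q)

/-- The number of integer cells meeting `[P/M, Q/M]`. -/
def cells (M P Q : ℕ) : ℕ := (Q - 1) / M - P / M + 1

/-- `δ(P/M, Q/M)` with the exact fuel. -/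
def deltaE (M P Q : ℕ) : MI := deltaEnc M (cells M P Q) P Q

/-- FINITE WINDOW `[A/E, A'/E]`, feature `x = X/D ≥ 0`: encloses `jT x U − jT x V = x·(δ(U,V) − δ(Ux,Vx))`
(`dUV` = an enclosure of `δ(U,V)`; the value `0` at `X ≤ 0` is used only at `X = 0`). -/
def jWinEnc (D E A A' : ℕ) (dUV : MI) (X : ℤ) : MI :=
  if X ≤ 0 then zI else
    ((dUV.sub (deltaE (E * D) (A * X.toNat) (A' * X.toNat))).mulInt X).divNat D

/-- TAIL WINDOW `[A/E, ∞)`, feature `x = X/D ≥ 0`: encloses `jT x U = x·log x + x·δ(U,Ux)` (`x ≥ 1`) /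
`x·log x − x·δ(Ux,U)` (`x < 1`) (`LD` = an enclosure of `log D`; junk `0` if the logarithm of `X` fails — excluded
by `tailPred`). -/
def jTailEnc (D E A : ℕ) (LD : MI) (X : ℤ) : MI :=
  if X ≤ 0 then zI else
    match lnNat X.toNat with
    | none => zI
    | some LX =>
      if D ≤ X.toNat then (((LX.sub LD).add (deltaE (E * D) (A * D) (A * X.toNat))).mulInt X).divNat D
      else (((LX.sub LD).sub (deltaE (E * D) (A * X.toNat) (A * D))).mulInt X).divNat D

/-- The tail encloser's success predicate for a feature numerator. -/
def tailPred (X : ℤ) : Bool := decide (X ≤ 0) || (lnNat X.toNat).isSome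

/-- `Σ_{i<7}` of intervals, written out. -/
def sum7 (f : Fin 7 → MI) : MI :=
  ((((((f 0).add (f 1)).add (f 2)).add (f 3)).add (f 4)).add (f 5)).add (f 6)

/-- Integer coordinate `i` of the direction numerators `pt` (`t_i = pt_i / D`). -/
def Pz (pt : List ℕ) (i : Fin 8) : ℤ := (pt.getD i 0 : ℕ)

/-- The member pattern `memShape` on the computable side: `f X` encloses `g(X/D)` for each feature numerator `X`
(orientation of the difference features decided from the integers `pt`). -/
def memShapeEnc (pt : List ℕ) (v w : Fin 7) (f : ℤ → MI) : MI :=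
  (((((((f (Pz pt 0 + Pz pt v.succ)).add (f (Pz pt 0 - Pz pt v.succ))).sub
      ((f (Pz pt v.succ + Pz pt w.succ)).mulInt 2)).add
    (sum7 fun i => if i = v ∨ i = w then zI else
      if Pz pt i.succ ≤ Pz pt v.succ then f (Pz pt v.succ - Pz pt i.succ)
      else (f (Pz pt i.succ - Pz pt v.succ)).neg)).sub
    (sum7 fun j => if j = v ∨ j = w then zI else f (Pz pt v.succ + Pz pt j.succ))).add
    ((((((f (Pz pt 3 + Pz pt 5)).add (f (Pz pt 4 + Pz pt 6))).add (f (Pz pt 1 + Pz pt 6))).add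
      (f (Pz pt 1 + Pz pt 7))).add (f (Pz pt 4 + Pz pt 5))).add (f (Pz pt 2 + Pz pt 7)))).sub
    (f (Pz pt 0 - Pz pt 2))).sub (f (Pz pt 0 - Pz pt 3))

/-- Conjunction over `Fin 7`, written out. -/
def all7 (b : Fin 7 → Bool) : Bool := b 0 && b 1 && b 2 && b 3 && b 4 && b 5 && b 6

/-- A predicate holds at all 25 feature numerators of member `(v,w)` at `pt`. -/
def memShapeAll (pt : List ℕ) (v w : Fin 7) (pr : ℤ → Bool) : Bool :=
  pr (Pz pt 0 + Pz pt v.succ) && pr (Pz pt 0 - Pz pt v.succ) && pr (Pz pt v.succ + Pz pt w.succ) &&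
  (all7 fun i => if i = v ∨ i = w then true else
      if Pz pt i.succ ≤ Pz pt v.succ then pr (Pz pt v.succ - Pz pt i.succ) else pr (Pz pt i.succ - Pz pt v.succ)) &&
  (all7 fun j => if j = v ∨ j = w then true else pr (Pz pt v.succ + Pz pt j.succ)) &&
  pr (Pz pt 3 + Pz pt 5) && pr (Pz pt 4 + Pz pt 6) && pr (Pz pt 1 + Pz pt 6) && pr (Pz pt 1 + Pz pt 7) &&
  pr (Pz pt 4 + Pz pt 5) && pr (Pz pt 2 + Pz pt 7) && pr (Pz pt 0 - Pz pt 2) && pr (Pz pt 0 - Pz pt 3)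

/-- The flip count `c_w = 1 + #{i ∉ {v,w} : pt_i > pt_v}` from the integers. -/
def cnt (pt : List ℕ) (v w : Fin 7) : ℕ :=
  let b : Fin 7 → ℕ := fun i => if i = v ∨ i = w then 0 else if Pz pt i.succ ≤ Pz pt v.succ then 0 else 1
  1 + (b 0 + b 1 + b 2 + b 3 + b 4 + b 5 + b 6)

/-- The finite window `[A/E, A'/E]` with member `vw`: encloses `c(1/U − 1/V) − (T(U) − T(V))`. -/
def winTerm (pt : List ℕ) (D E A A' : ℕ) (vw : Fin 7 × Fin 7) : MI :=
  ((MI.ofFrac SC ((cnt pt vw.1 vw.2 * E : ℕ) : ℤ) A).sub (MI.ofFrac SC ((cnt pt vw.1 vw.2 * E : ℕ) : ℤ) A')).sub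
    (memShapeEnc pt vw.1 vw.2 (jWinEnc D E A A' (deltaE E A A')))

/-- The tail window `[A/E, ∞)` with member `vw`: encloses `c/U − T(U)`. -/
def tailTerm (pt : List ℕ) (D E A : ℕ) (LD : MI) (vw : Fin 7 × Fin 7) : MI :=
  (MI.ofFrac SC ((cnt pt vw.1 vw.2 * E : ℕ) : ℤ) A).sub (memShapeEnc pt vw.1 vw.2 (jTailEnc D E A LD))

/-- All windows: cut numerators `A₀, …, A_W` (over `E`) and members `(v_w, w_w)`, by recursion over the lists. -/
def winSum (pt : List ℕ) (D E : ℕ) (LD : MI) : List ℕ → List (Fin 7 × Fin 7) → MI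
  | [A], [vw] => tailTerm pt D E A LD vw
  | A :: A' :: As, vw :: vws => (winTerm pt D E A A' vw).add (winSum pt D E LD (A' :: As) vws)
  | _, _ => zI

/-- The 28 forms of `h28_aOfS` in its order: `(i, j, false)` = `s_i + s_j`, `(i, j, true)` = `s_i − s_j`. -/
def wallForm : Fin 28 → Fin 8 × Fin 8 × Bool :=
  ![(1,2,false), (0,2,true), (2,3,false), (0,3,true), (3,4,false), (5,6,false), (6,7,false), (3,5,false),
    (1,3,false), (1,4,false), (1,5,false), (0,4,true), (0,5,true), (2,6,false), (0,1,true), (2,4,false), (0,6,true),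
    (2,5,false), (4,6,false), (3,7,false), (1,6,false), (1,7,false), (3,6,false), (0,7,true), (4,5,false), (2,7,false),
    (5,7,false), (4,7,false)]

/-- Numerator of a form at `pt`. -/
def wallNum (pt : List ℕ) (f : Fin 8 × Fin 8 × Bool) : ℤ :=
  if f.2.2 then Pz pt f.1 - Pz pt f.2.1 else Pz pt f.1 + Pz pt f.2.1

/-- First-wall condition `U₀·h_k ≤ 1` for all 28 forms: `A₀ · num_k ≤ E · D`. -/
def wallOK (pt : List ℕ) (E A0 D : ℕ) : Bool :=
  (List.finRange 28).all fun k => decide ((A0 : ℤ) * wallNum pt (wallForm k) ≤ ((E * D : ℕ) : ℤ))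

/-- Direction data: `D > 0`, `pt₀ = D` (`t₀ = 1`), `pt_i ≤ D` (`t_i ≤ 1`) for `i < 8`. -/
def ptOK (pt : List ℕ) (D : ℕ) : Bool :=
  decide (0 < D) && decide (pt.getD 0 0 = D) && (List.range 8).all fun i => decide (pt.getD i 0 ≤ D)

/-- Non-decreasing list. -/
def sortedLE : List ℕ → Bool
  | a :: b :: l => decide (a ≤ b) && sortedLE (b :: l)
  | _ => true

/-- Cut data: `E > 0`, `A₀ > 0`, cuts non-decreasing, as many members as cuts (≥ 1), members with `v ≠ w`. -/
def cutsOK (E : ℕ) (cuts : List ℕ) (mems : List (Fin 7 × Fin 7)) : Bool :=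
  decide (0 < E) && decide (0 < cuts.getD 0 0) && sortedLE cuts && decide (cuts.length = mems.length) &&
    decide (0 < cuts.length) && mems.all fun vw => decide (vw.1 ≠ vw.2)

/-- The tail member (last of the list). -/
def lastMem (mems : List (Fin 7 × Fin 7)) : Fin 7 × Fin 7 := mems.getD (mems.length - 1) (0, 1)

/-- The common part of the checks: well-formedness, first wall, tail logarithms; returns the enclosure of `winForm`. -/
def winEnc (pt : List ℕ) (D E : ℕ) (cuts : List ℕ) (mems : List (Fin 7 × Fin 7)) : Option MI :=
  if ptOK pt D && cutsOK E cuts mems && wallOK pt E (cuts.getD 0 0) D then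
    match lnNat D with
    | none => none
    | some LD =>
      if memShapeAll pt (lastMem mems).1 (lastMem mems).2 tailPred then some (winSum pt D E LD cuts mems)
      else none
  else none

/-- **Upper check**: `winForm ≤ p/q` at the direction `pt/D` with cuts `cuts/E` and members `mems`. -/
def winCheck (pt : List ℕ) (D E : ℕ) (cuts : List ℕ) (mems : List (Fin 7 × Fin 7)) (p : ℤ) (q : ℕ) : Bool :=
  decide (0 < q) &&
    match winEnc pt D E cuts mems with
    | some I => decide (I.hi * (q : ℤ) ≤ p * (SC : ℤ))
    | none => false

/-- **Two-sided check**: `pl/q ≤ winForm ≤ pu/q`. -/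
def winCheck2 (pt : List ℕ) (D E : ℕ) (cuts : List ℕ) (mems : List (Fin 7 × Fin 7)) (pl pu : ℤ) (q : ℕ) :
    Bool :=
  decide (0 < q) &&
    match winEnc pt D E cuts mems with
    | some I => decide (pl * (SC : ℤ) ≤ I.lo * (q : ℤ)) && decide (I.hi * (q : ℤ) ≤ pu * (SC : ℤ))
    | none => false

end LemmaFWin

end Summit.KontsevichZagierPeriods.Zeta5Search.Barrier.ConeGamma
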